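import Summits.AtomisticToContinuum.HydrodynamicLimit.Theses.OneFlightGossipEngine
import Summits.AtomisticToContinuum.HydrodynamicLimit.Theorems.BandCoherenceLDAlongFamilies.Negative.Pathwise
import Summits.AtomisticToContinuum.HydrodynamicLimit.Theorems.BandCoherenceLDAlongFamilies.Negative.Gauss
import HarnessLib

/-!
# Disproof of `BandCoherenceLDAlongFamilies` (crux stmt-AtomisticToContinuum-17700) — findings

Standing disprover: refuter-cdisprove-stmt-AtomisticToContinuum-17700-0 (cycle 1, 2026-08-17).

## VERDICT: the crux is FALSE as typed — Galilean-boost (drift) witness, class `refuted-misstated`.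

Refutation LANDED: **p145478** (commit fc4167e0291d) = `Theorems/OneFlightGossipEngineBandCoherenceLDAlongFamiliesRefutation.lean`,
theorem `OneFlightGossipEngineBandCoherenceLDAlongFamilies_refuted : ¬ BandCoherenceLDAlongFamilies` (rc 0, axioms
propext/Classical.choice/Quot.sound); its helpers LANDED as `Theorems/BandCoherenceLDAlongFamilies/Negative/BoostFloor.lean`
(**p145191**, namespace `Theorems.BandCoherenceLDBoostFloor`: `floor_general`, `boost_floor`, `integral_window_vel`,
`linear_sum_le`); the item is CLOSED `refuted` by the gate (2026-08-17). The same mechanism was found independently by refuter-rattack-17700-0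
(WITNESS.md; landed helpers `Negative/Pathwise.lean` p142995, `Negative/Gauss.lean` p144087 — both reused) and by the
crux ideators k1/k2 (IdeatorOneNotes-r1.md, IdeatorTwoBoostWitnessAndRepair.md).

### (a) Load-bearing analysis
* The ONLY dynamical input the disproof uses is INVARIANCE of the boosted homogeneous Gibbs law `G_D` (drift `D e₀`,
  `a = θ = 1`) under every hard-sphere flow (`BoltzmannGreenKuboOrthMomentum.map_flow_localGibbsLaw_const`: Liouville +
  conservation of `Σ|vᵢ − De₀|²`). Hence NO hypothesis on the flow, the window `τ`, or `N` can save the statement: the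
  floor holds for every `Φ`, `w > 0`, `N` (`BandCoherenceLDBoostFloor.boost_floor`).
* The load-bearing DEFECT of the statement is the quantifier pair "fixed tilt `(8Θ̄K₁)⁻¹`" + "`∀ η > 0`": a uniform drift
  of size `D` costs `D²/2` per particle (quadratic) but is a conserved coherent band current paid LINEARLY by the tilt
  (`≈ 5D/(8K₁)` per particle for the weight `R(s′) = (s′−k²)1{k²<s′≤K²}`), so the per-particle pressure is
  `≥ 25/(128K₁²) − O(η) > 0` for small `η`, uniformly in `τ, N`.
* `∀ R` (measurable, `R = 0` below `K⋆²`, `|R| ≤ |s′|`) is what lets the refuter pick a weight with non-zero linear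
  response; restricting `R` does not obviously help (ideator k2: even `|v|²`-orthogonalised weights keep a static band
  pressure `Λ_band(λ) > 0` at the fixed tilt).

### (b) Tightness / what a repair must respect
* Any repaired statement at a FIXED tilt `λ` independent of `ε` inherits the floor `λ·γ(D) − D²/2 ≥ λ²γ′(0)²/2 > 0`
  (optimise `D`): the tilt must be chosen AFTER `ε` (`∀ ε ∃ β₀ ∀ |β| ≤ β₀ …`, floor `O(β²)`), or the functional must be
  made blind to Galilean/thermal soft modes (signed, Mazur-shifted band current — the ideators' R1).
* Momentum-shell conditioning is NOT a repair (ideator k1: a zero-total-momentum SHEAR drift `±D e₀` on two half-tori has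
  the same linear response at the same quadratic cost, up to the interface layer).

### (c) Natural strengthenings — all dead with the crux (nothing further to record).

### (d) Targets — none (no line was registered; PICKED.md = boost-witness-refutation by the lead).

### (e) Near-misses — none: the kill is unconditional.

This workfile only INDEXES the findings; the checked mathematics is in the refutation file and the two landed helper
files. Below: the two admissibility facts of the witness weight, restated as a sanity anchor for readers.
-/

noncomputable section

namespace Summit.AtomisticToContinuum.HydrodynamicLimit.Cruxes.BandCoherenceLDAlongFamilies.Disproof

open MeasureTheory
open scoped ENNReal BigOperators
open Summit.AtomisticToContinuum.HydrodynamicLimit.Theorems.BandCoherenceLDNegative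

/-- The witness weight `R(s′) = (s′ − k²)·1{k² < s′ ≤ K²}` is admissible for the crux: it vanishes below `k²`
(restated from `Negative/Pathwise.lean`). [folklore] -/
theorem witnessWeight_vanishes {k K s' : ℝ} (h : s' ≤ k ^ 2) :
    (if k ^ 2 < s' ∧ s' ≤ K ^ 2 then s' - k ^ 2 else 0) = 0 :=
  Rrad_eq_zero_of_le h

/-- … and is dominated by `|s′|` (restated from `Negative/Pathwise.lean`). [folklore] -/
theorem witnessWeight_abs_le (k K s' : ℝ) : |(if k ^ 2 < s' ∧ s' ≤ K ^ 2 then s' - k ^ 2 else 0)| ≤ |s'| :=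
  abs_Rrad_le k K s'


/-! ## The repaired statement `C′` (candidate, for the planner) — NOT a citable fact, nothing is claimed about it here

`BandCoherenceLDAlongFamiliesSmallTilt` is the crux VERBATIM except that the FIXED tilt `(8 * Θbar * K₁)⁻¹` is replaced
by a tilt `β ∈ (0, β₀]` with `β₀` chosen AFTER `η, ε` (`… ∀ η > 0 ∀ ε > 0 ∃ β₀ > 0 ∀ β ∈ (0, β₀] ∃ τ₀ …`). The boost
witness MISSES it: its floor is `sup_D (β γ(D) − D²/2θ) = O(β²)`, below `ε` once `β₀ ≲ √ε`. Whether `C′` can still pay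
the band inside the dock's Grönwall (the tilt there is pinned to `(8Θ̄K₁)⁻¹` by `band_expectation`) is the planner's
question (ideators' R1/R2); `Θbar` is kept only to stay byte-close to the crux. -/

def BandCoherenceLDAlongFamiliesSmallTilt : Prop :=
  ∃ η₀ : ℝ, 0 < η₀ ∧ ∀ (t₁ Θbar : ℝ) (a θ₀ : ℝ → Literature.MathematicalPhysics.KineticTheory.T3 → ℝ) (u₀ : ℝ → Literature.MathematicalPhysics.KineticTheory.T3 → Literature.MathematicalPhysics.KineticTheory.V3), Continuous (Function.uncurry a) → Continuous (Function.uncurry θ₀) → Continuous (Function.uncurry u₀) → (∀ s x, 0 < a s x) → (∀ s x, 0 < θ₀ s x) → (∀ s ∈ Set.Icc 0 t₁, ∀ x, θ₀ s x ≤ Θbar) → ∀ σ : ℝ, 0 < σ → (∀ s ∈ Set.Icc 0 t₁, σ ^ 3 * (⨆ x, a s x) ≤ η₀ * ∫ x, a s x) → ∀ Φ : (N : ℕ) → Literature.Analysis.FluidPDE.HardSphereFlow (Literature.Analysis.FluidPDE.Torus.geometry (Fin 3)) (Literature.MathematicalPhysics.KineticTheory.hsDiameter σ N) (N + 1), ∀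 Kstar K₁ : ℝ, 0 < Kstar → Kstar ≤ K₁ → ∀ R : ℝ → Literature.MathematicalPhysics.KineticTheory.T3 → ℝ → ℝ, Measurable (fun p : ℝ × Literature.MathematicalPhysics.KineticTheory.T3 × ℝ => R p.1 p.2.1 p.2.2) → (∀ s x s', s' ≤ Kstar ^ 2 → R s x s' = 0) → (∀ s x s', |R s x s'| ≤ |s'|) → ∀ η : ℝ, 0 < η → ∀ ε : ℝ, 0 < ε → ∃ β₀ : ℝ, 0 < β₀ ∧ ∀ β : ℝ, 0 < β → β ≤ β₀ → ∃ τ₀ : ℝ, 0 < τ₀ ∧ ∀ τ : ℝ, τ₀ ≤ τ → ∃ N₀ : ℕ, ∀ N : ℕ, N₀ ≤ N → ∀ s ∈ Set.Icc 0 t₁, (let w : ℝ := τ * ((N : ℝ) + 1) ^ (-(1 / 3 : ℝ)); let P := Literature.MathematicalPhysics.KineticTheory.localGibbsLaw σ (a s) (u₀ s) (θ₀ s) N (Φ N); let W := fun (i : Fin (N + 1)) (r : ℝ) z => ((Φ N).flow r z i).2 - u₀ s ((Φ N).flow r z i).1; let cub := fun (i : Fin (N + 1)) z => w⁻¹ *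 ∫ r in (0 : ℝ)..w, ‖W i r z‖ ^ 3; let cubBand := fun (i : Fin (N + 1)) z => w⁻¹ * ∫ r in (0 : ℝ)..w, (if Kstar < ‖W i r z‖ ∧ ‖W i r z‖ ≤ K₁ then ‖W i r z‖ ^ 3 else 0); let qbar := fun (i : Fin (N + 1)) z => w⁻¹ • ∫ r in (0 : ℝ)..w, (R s ((Φ N).flow r z i).1 (‖W i r z‖ ^ 2)) • W i r z; ∫⁻ z, ENNReal.ofReal (Real.exp (β * ∑ i : Fin (N + 1), (if η * cub i z < ‖qbar i z‖ then cubBand i z else 0))) ∂P ≤ ENNReal.ofReal (Real.exp (ε * ((N : ℝ) + 1))))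

end Summit.AtomisticToContinuum.HydrodynamicLimit.Cruxes.BandCoherenceLDAlongFamilies.Disproof

end
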